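import Summits.NavierStokesRegularity.NavierStokesRegularity.Theorems.SymmetryModuliCountForcedSymmetryRdssLiouvilleTauReduction
import Literature.Analysis.FluidPDE.VorticityDoubleConeRegularity
import Literature.Analysis.FluidPDE.LocalTypeI
import Literature.Analysis.FluidPDE.SelfSimilar
import Literature.Analysis.FluidPDE.ClassicalSolution
import HarnessLib

/-!
# `SymmetryModuliCount.ForcedSymmetry` (crux stmt-NavierStokesRegularity-4052), line
# `recurrent-closing` (skeleton gen 5), stub `stub_decayOfSatelliteFree` — Chae–Wolf's decay step

Support file (everything proved) for the stub `stub_decayOfSatelliteFree`, shared VERBATIM with stub 2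
of the birth skeleton of crux stmt-NavierStokesRegularity-8561
(`Cruxes/RDSSLiouvilleInClass/Lines/birth.lean`).

Statement.  A classical field `w` on `(−∞, 0) × ℝ³` with the Type-I time rate
`‖w(t,x)‖ ≤ C/√(−t)` (`HasTypeITimeDecay C w`), invariant a.e. on the slab under ONE similarity
`(t, x) ↦ l • R⁻¹ (w (l² t) (l R x))` with `l > 1`, all of whose final-slice points `(0, y)` with
`y ≠ l R y` (equivalently `y ≠ 0`) are regular, has SPACE–time Type-I decay
`‖w(t,x)‖ ≤ C₀/(‖x‖ + √(−t))` (`HasTypeIDecay C₀ w`).  This is the scaling step in the proof of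
Chae–Wolf 2017, Thm. 1.1 (estimate (1.5)); it uses no Navier–Stokes input.

Proof.
1. For a classical profile the a.e. clause holds pointwise on `t < 0`
   (`rdssInvariant_pointwise_of_classical`), whence the NORM identities along the scaling group:
   for every `n : ℤ`, `t < 0`, `x` there is `y` with `‖y‖ = lⁿ ‖x‖` and
   `‖w(t,x)‖ = lⁿ ‖w(l²ⁿ t, y)‖` (only norms of positions are tracked, so no powers of `R` occur).
2. Every `y` with `1 ≤ ‖y‖ ≤ l` is a regular point `(0, y)`: `w` is essentially bounded on some
   backward cylinder `Q((0,y), r)`, hence (continuity on the open slab,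
   `Measure.eqOn_open_of_ae_eq`) pointwise bounded there; compactness of the annulus
   (`IsCompact.induction_on`) gives `‖w‖ ≤ M` on `(−δ², 0) × {1 ≤ ‖x‖ ≤ l}`.
3. For `x ≠ 0` pick `n` with `1 ≤ lⁿ‖x‖ < l` (`exists_mem_Ico_zpow`).  If `l²ⁿ(−t) < δ²` then
   `‖w(t,x)‖ ≤ lⁿ M ≤ l M/‖x‖` and `√(−t) < δ‖x‖`; otherwise `δ‖x‖ ≤ l √(−t)` and the time rate
   applies.  Both are `≤ C₀/(‖x‖ + √(−t))` with `C₀ = max (C (l/δ + 1)) (l M (1 + δ))`.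

References: D. Chae, J. Wolf, CPDE 42 (2017), Thm. 1.1 [ChaeWolf2017RemovingDSS].
-/

noncomputable section

-- the summit and its single problem share the name (D-0017 nested layout)
set_option linter.dupNamespace false

open MeasureTheory Set Function Metric Filter Topology
open scoped ENNReal
open Literature.Analysis.FluidPDE

namespace Summit.NavierStokesRegularity.NavierStokesRegularity.Theorems.SymmetryModuliCountForcedSymmetry

/-- Local notation for physical space `ℝ³ = EuclideanSpace ℝ (Fin 3)` (the registered stub signature is
spelled with it). -/
local notation "ℝ³" => EuclideanSpace ℝ (Fin 3)

/-- **Regular final-slice point ⇒ pointwise bound on a backward cylinder** for a field continuous on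
the open slab `t < 0`: an essential bound on the open cylinder `Q((0,y), r) ⊆ {t < 0}` is a
pointwise bound there (`Measure.eqOn_open_of_ae_eq` applied to `‖w‖ ⊓ M` and `‖w‖`). [folklore] -/
private theorem exists_bound_near_of_not_isBackwardSingularPoint
    {w : ℝ → ℝ³ → ℝ³}
    (hwc : ContinuousOn (uncurry w) (Iio (0 : ℝ) ×ˢ univ)) {y : ℝ³}
    (hy : ¬ IsBackwardSingularPoint w ((0 : ℝ), y)) :
    ∃ r : ℝ, 0 < r ∧ ∃ M : ℝ, ∀ t : ℝ, -r ^ 2 < t → t < 0 →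
      ∀ x : ℝ³, dist x y < r → ‖w t x‖ ≤ M := by
  obtain ⟨r, hr, hfin⟩ := not_isBackwardSingularPoint_iff.1 hy
  set Q : Set (ℝ × ℝ³) := parabolicCylinder r ((0 : ℝ), y) with hQ
  set S : ℝ≥0∞ := eLpNorm (uncurry w) ∞ (volume.restrict Q) with hS
  have hae : ∀ᵐ z ∂(volume.restrict Q), ‖uncurry w z‖ ≤ S.toReal := by
    have h1 : ∀ᵐ z ∂(volume.restrict Q), ‖uncurry w z‖ₑ ≤ S := by
      rw [hS, eLpNorm_exponent_top]
      exact ae_le_eLpNormEssSup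
    filter_upwards [h1] with z hz
    rw [← toReal_enorm]
    exact ENNReal.toReal_mono hfin.ne hz
  have hQsub : Q ⊆ Iio (0 : ℝ) ×ˢ univ := by
    intro z hz
    rw [hQ, mem_parabolicCylinder] at hz
    exact ⟨hz.1.2, mem_univ _⟩
  have hcQ : ContinuousOn (fun z : ℝ × ℝ³ => ‖uncurry w z‖) Q :=
    (hwc.mono hQsub).norm
  have heq : EqOn (fun z : ℝ × ℝ³ => ‖uncurry w z‖ ⊓ S.toReal)
      (fun z => ‖uncurry w z‖) Q :=
    Measure.eqOn_open_of_ae_eq (hae.mono fun z hz => inf_eq_left.2 hz)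
      (isOpen_parabolicCylinder r _) (hcQ.inf continuousOn_const) hcQ
  refine ⟨r, hr, S.toReal, fun t ht1 ht2 x hx => ?_⟩
  have hmem : ((t, x) : ℝ × ℝ³) ∈ Q := by
    rw [hQ, mem_parabolicCylinder]
    exact ⟨⟨by rw [zero_sub]; exact ht1, ht2⟩, hx⟩
  have h := heq hmem
  simp only [uncurry_apply_pair] at h
  rw [← h]
  exact inf_le_right

/-- **Uniform bound near the annulus `1 ≤ ‖x‖ ≤ l` at times near `0`.** If `w` is continuous on the
open slab and every `(0, y)`, `y ≠ 0`, is a regular point, then `‖w t x‖ ≤ M` for `−δ² < t < 0`,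
`1 ≤ ‖x‖ ≤ l`, for some `δ > 0`, `M` (compactness of the annulus, `IsCompact.induction_on`).
[folklore] -/
private theorem exists_bound_near_annulus
    {w : ℝ → ℝ³ → ℝ³}
    (hwc : ContinuousOn (uncurry w) (Iio (0 : ℝ) ×ˢ univ))
    (hreg : ∀ y : ℝ³, y ≠ 0 → ¬ IsBackwardSingularPoint w ((0 : ℝ), y))
    (l : ℝ) :
    ∃ δ : ℝ, 0 < δ ∧ ∃ M : ℝ, ∀ t : ℝ, -δ ^ 2 < t → t < 0 →
      ∀ x : ℝ³, 1 ≤ ‖x‖ → ‖x‖ ≤ l → ‖w t x‖ ≤ M := by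
  set K : Set (ℝ³) := {x | 1 ≤ ‖x‖ ∧ ‖x‖ ≤ l} with hK
  have hKc : IsCompact K := by
    refine (isCompact_closedBall (0 : ℝ³) l).of_isClosed_subset ?_ ?_
    · exact (isClosed_le continuous_const continuous_norm).inter
        (isClosed_le continuous_norm continuous_const)
    · intro x hx
      rw [mem_closedBall, dist_zero_right]
      exact hx.2
  -- linear time windows `-ε < t < 0` along the induction over the compact annulus
  have hP : ∃ ε : ℝ, 0 < ε ∧ ∃ M : ℝ, ∀ t : ℝ, -ε < t → t < 0 → ∀ x ∈ K, ‖w t x‖ ≤ M := by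
    refine hKc.induction_on
      (p := fun A => ∃ ε : ℝ, 0 < ε ∧ ∃ M : ℝ, ∀ t : ℝ, -ε < t → t < 0 → ∀ x ∈ A, ‖w t x‖ ≤ M)
      ?_ ?_ ?_ ?_
    · exact ⟨1, one_pos, 0, fun t _ _ x hx => hx.elim⟩
    · rintro A B hAB ⟨ε, hε, M, hM⟩
      exact ⟨ε, hε, M, fun t h1 h2 x hx => hM t h1 h2 x (hAB hx)⟩
    · rintro A B ⟨ε₁, hε₁, M₁, h₁⟩ ⟨ε₂, hε₂, M₂, h₂⟩
      refine ⟨min ε₁ ε₂, lt_min hε₁ hε₂, max M₁ M₂, fun t h1 h2 x hx => ?_⟩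
      rcases hx with hx | hx
      · exact (h₁ t (by linarith [min_le_left ε₁ ε₂]) h2 x hx).trans (le_max_left _ _)
      · exact (h₂ t (by linarith [min_le_right ε₁ ε₂]) h2 x hx).trans (le_max_right _ _)
    · intro y hy
      have hy0 : y ≠ 0 := by
        rintro rfl
        rw [hK, mem_setOf_eq, norm_zero] at hy
        linarith [hy.1]
      obtain ⟨r, hr, M, hM⟩ := exists_bound_near_of_not_isBackwardSingularPoint hwc (hreg y hy0)
      exact ⟨ball y r, mem_nhdsWithin_of_mem_nhds (ball_mem_nhds y hr), r ^ 2, by positivity, M,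
        fun t h1 h2 x hx => hM t h1 h2 x (mem_ball.1 hx)⟩
  obtain ⟨ε, hε, M, hM⟩ := hP
  refine ⟨Real.sqrt ε, Real.sqrt_pos.2 hε, M, fun t h1 h2 x hx1 hx2 => hM t ?_ h2 x ⟨hx1, hx2⟩⟩
  rwa [Real.sq_sqrt hε.le] at h1

/-- **Composition of two norm-scaling identities.** If the norms of `w` scale by the factor `a`
(to points of `a`-fold norm and times `a² t`) and by the factor `b`, then they scale by `a b`.
[folklore] -/
private theorem normScale_mul {w : ℝ → ℝ³ → ℝ³}
    {a b : ℝ} (ha : 0 < a)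
    (hA : ∀ t < (0 : ℝ), ∀ x : ℝ³, ∃ y : ℝ³,
      ‖y‖ = a * ‖x‖ ∧ ‖w t x‖ = a * ‖w (a ^ 2 * t) y‖)
    (hB : ∀ t < (0 : ℝ), ∀ x : ℝ³, ∃ y : ℝ³,
      ‖y‖ = b * ‖x‖ ∧ ‖w t x‖ = b * ‖w (b ^ 2 * t) y‖) :
    ∀ t < (0 : ℝ), ∀ x : ℝ³, ∃ y : ℝ³,
      ‖y‖ = a * b * ‖x‖ ∧ ‖w t x‖ = a * b * ‖w ((a * b) ^ 2 * t) y‖ := by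
  intro t ht x
  obtain ⟨y₁, hy₁, h₁⟩ := hA t ht x
  obtain ⟨y₂, hy₂, h₂⟩ := hB (a ^ 2 * t) (mul_neg_of_pos_of_neg (pow_pos ha 2) ht) y₁
  refine ⟨y₂, ?_, ?_⟩
  · rw [hy₂, hy₁]; ring
  · rw [h₁, h₂, show (a * b) ^ 2 * t = b ^ 2 * (a ^ 2 * t) by ring]; ring

/-- **Iteration of a norm-scaling identity**: the factor `a` iterates to `a ^ n`. [folklore] -/
private theorem normScale_pow {w : ℝ → ℝ³ → ℝ³}
    {a : ℝ} (ha : 0 < a)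
    (hA : ∀ t < (0 : ℝ), ∀ x : ℝ³, ∃ y : ℝ³,
      ‖y‖ = a * ‖x‖ ∧ ‖w t x‖ = a * ‖w (a ^ 2 * t) y‖) :
    ∀ n : ℕ, ∀ t < (0 : ℝ), ∀ x : ℝ³, ∃ y : ℝ³,
      ‖y‖ = a ^ n * ‖x‖ ∧ ‖w t x‖ = a ^ n * ‖w ((a ^ n) ^ 2 * t) y‖ := by
  intro n
  induction n with
  | zero => intro t _ x; exact ⟨x, by simp, by simp⟩
  | succ n ih => rw [pow_succ]; exact normScale_mul (pow_pos ha n) ih hA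

/-- `a / p ≤ a k / d` once `d ≤ k p` (`0 ≤ a`, `0 < p`, `0 < d`): trading a denominator for a
constant. [folklore] -/
private theorem div_le_mul_div_of_le {a p d k : ℝ} (ha : 0 ≤ a) (hp : 0 < p) (hd : 0 < d)
    (h : d ≤ k * p) : a / p ≤ a * k / d := by
  rw [div_le_div_iff₀ hp hd]
  calc a * d ≤ a * (k * p) := mul_le_mul_of_nonneg_left h ha
    _ = a * k * p := by ring

/-- **Stub `stub_decayOfSatelliteFree` (Chae–Wolf's decay step; no Navier–Stokes input).** A classical
profile on `(−∞,0)` with the time rate `‖w(t,x)‖ ≤ C/√(−t)`, RDSS about the origin a.e. on the slab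
(`(t,x) ↦ l • R⁻¹ w (l²t) (l R x)`, `l > 1`), all of whose final-slice points `y ≠ l R y`
(equivalently `y ≠ 0`) are regular, obeys `‖w(t,x)‖ ≤ C₀/(‖x‖ + √(−t))` for `t < 0`
(`HasTypeIDecay C₀ w`) for some `C₀`: pointwise invariance on `t < 0`
(`rdssInvariant_pointwise_of_classical`), a bound `M` on `(−δ², 0) × {1 ≤ ‖x‖ ≤ l}` by regularity and
compactness, iteration of the similarity where `δ ‖x‖ > l √(−t)`, the time rate elsewhere;
`C₀ = max (C (l/δ + 1)) (l M (1 + δ))`. [cite: ChaeWolf2017RemovingDSS, proof of Thm. 1.1, (1.5)] -/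
theorem stub_decayOfSatelliteFree :
    ∀ (w : ℝ → ℝ³ → ℝ³) (q : ℝ → ℝ³ → ℝ) (C : ℝ),
      HasTypeITimeDecay C w →
      IsClassicalNSSolutionOn (Set.Iio 0) 1 0 w q →
      ∀ (l : ℝ) (R : ℝ³ ≃ₗᵢ[ℝ] ℝ³), 1 < l →
        (fun z : ℝ × ℝ³ => l • R.symm (w (l ^ 2 * z.1) (l • R z.2)))
          =ᵐ[volume.restrict (Set.Iio (0 : ℝ) ×ˢ Set.univ)] (fun z : ℝ × ℝ³ => w z.1 z.2) →
        (∀ y : ℝ³, y ≠ l • R y → ¬ IsBackwardSingularPoint w ((0 : ℝ), y)) →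
        ∃ C₀ : ℝ, HasTypeIDecay C₀ w := by
  intro w q C hdec hcl l R hl hinv hreg
  have hl0 : 0 < l := zero_lt_one.trans hl
  have hC : 0 ≤ C := by
    have h := hdec (-1) (by norm_num) 0
    rw [neg_neg, Real.sqrt_one, div_one] at h
    exact (norm_nonneg _).trans h
  -- (1) pointwise invariance on the open slab
  have hpt : ∀ t < (0 : ℝ), ∀ x : ℝ³,
      l • R.symm (w (l ^ 2 * t) (l • R x)) = w t x := by
    have h := rdssInvariant_pointwise_of_classical (τ := 0) R 0 hcl hl0 le_rfl
      (by simpa only [add_zero] using hinv)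
    simpa only [add_zero] using h
  -- (0) every `y ≠ 0` is a regular final-slice point (`‖l • R y‖ = l ‖y‖ ≠ ‖y‖` unless `y = 0`)
  have hreg0 : ∀ y : ℝ³, y ≠ 0 →
      ¬ IsBackwardSingularPoint w ((0 : ℝ), y) := by
    intro y hy0
    refine hreg y fun h => hy0 ?_
    have hn : ‖y‖ = l * ‖y‖ := by
      conv_lhs => rw [h]
      rw [norm_smul, Real.norm_of_nonneg hl0.le, LinearIsometryEquiv.norm_map]
    have h0 : ‖y‖ ≤ 0 := by nlinarith [norm_nonneg y]
    exact norm_le_zero_iff.1 h0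
  -- (2) uniform bound near the annulus
  obtain ⟨δ, hδ, M, hM⟩ := exists_bound_near_annulus hcl.smooth_velocity.continuousOn hreg0 l
  -- (1') norm identities along the scaling group `l ^ ℤ`
  have hplus : ∀ t < (0 : ℝ), ∀ x : ℝ³, ∃ y : ℝ³,
      ‖y‖ = l * ‖x‖ ∧ ‖w t x‖ = l * ‖w (l ^ 2 * t) y‖ := by
    intro t ht x
    refine ⟨l • R x, ?_, ?_⟩
    · rw [norm_smul, Real.norm_of_nonneg hl0.le, LinearIsometryEquiv.norm_map]
    · rw [← hpt t ht x, norm_smul, Real.norm_of_nonneg hl0.le, LinearIsometryEquiv.norm_map]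
  have hminus : ∀ t < (0 : ℝ), ∀ x : ℝ³, ∃ y : ℝ³,
      ‖y‖ = l⁻¹ * ‖x‖ ∧ ‖w t x‖ = l⁻¹ * ‖w (l⁻¹ ^ 2 * t) y‖ := by
    intro t ht x
    have ht' : l⁻¹ ^ 2 * t < 0 := mul_neg_of_pos_of_neg (by positivity) ht
    have key := hpt (l⁻¹ ^ 2 * t) ht' (R.symm (l⁻¹ • x))
    rw [LinearIsometryEquiv.apply_symm_apply, smul_inv_smul₀ hl0.ne',
      show l ^ 2 * (l⁻¹ ^ 2 * t) = t by field_simp] at key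
    refine ⟨R.symm (l⁻¹ • x), ?_, ?_⟩
    · rw [LinearIsometryEquiv.norm_map, norm_smul, Real.norm_of_nonneg (inv_nonneg.2 hl0.le)]
    · rw [← key, norm_smul, Real.norm_of_nonneg hl0.le, LinearIsometryEquiv.norm_map, ← mul_assoc,
        inv_mul_cancel₀ hl0.ne', one_mul]
  have hz : ∀ n : ℤ, ∀ t < (0 : ℝ), ∀ x : ℝ³, ∃ y : ℝ³,
      ‖y‖ = l ^ n * ‖x‖ ∧ ‖w t x‖ = l ^ n * ‖w ((l ^ n) ^ 2 * t) y‖ := by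
    intro n
    obtain ⟨k, rfl | rfl⟩ := Int.eq_nat_or_neg n
    · simpa only [zpow_natCast] using normScale_pow hl0 hplus k
    · simpa only [zpow_neg, zpow_natCast, inv_pow] using normScale_pow (inv_pos.2 hl0) hminus k
  -- (3) the decay estimate
  set M' : ℝ := max M 0 with hM'
  have hM'0 : 0 ≤ M' := le_max_right _ _
  have hk1 : 1 ≤ l / δ + 1 := le_add_of_nonneg_left (div_nonneg hl0.le hδ.le)
  refine ⟨max (C * (l / δ + 1)) (l * M' * (1 + δ)), fun t ht x => ?_⟩
  have hnt : 0 ≤ -t := (neg_pos.2 ht).le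
  have hst : 0 < Real.sqrt (-t) := Real.sqrt_pos.2 (neg_pos.2 ht)
  have hD : 0 < ‖x‖ + Real.sqrt (-t) := add_pos_of_nonneg_of_pos (norm_nonneg _) hst
  by_cases hx0 : x = 0
  · -- on the time axis the time rate alone suffices
    subst hx0
    rw [norm_zero, zero_add]
    exact (hdec t ht 0).trans (div_le_div_of_nonneg_right
      ((le_mul_of_one_le_right hC hk1).trans (le_max_left _ _)) hst.le)
  have hxpos : 0 < ‖x‖ := norm_pos_iff.2 hx0
  -- the scale `s = l ^ (-n)` with `1 ≤ s ‖x‖ < l`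
  obtain ⟨n, hn1, hn2⟩ := exists_mem_Ico_zpow hxpos hl
  obtain ⟨y, hy, hwy⟩ := hz (-n) t ht x
  set s : ℝ := l ^ (-n) with hs
  have hs0 : 0 < s := zpow_pos hl0 _
  have hsn : s * l ^ n = 1 := by
    rw [hs, zpow_neg]
    exact inv_mul_cancel₀ (zpow_pos hl0 n).ne'
  have hs1 : 1 ≤ s * ‖x‖ := by
    calc (1 : ℝ) = s * l ^ n := hsn.symm
      _ ≤ s * ‖x‖ := mul_le_mul_of_nonneg_left hn1 hs0.le
  have hs2 : s * ‖x‖ < l := by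
    calc s * ‖x‖ < s * l ^ (n + 1) := mul_lt_mul_of_pos_left hn2 hs0
      _ = l := by rw [zpow_add_one₀ hl0.ne', ← mul_assoc, hsn, one_mul]
  have hs2t : s ^ 2 * t < 0 := mul_neg_of_pos_of_neg (by positivity) ht
  have hsq : (s * Real.sqrt (-t)) ^ 2 = s ^ 2 * (-t) := by rw [mul_pow, Real.sq_sqrt hnt]
  by_cases hcase : -δ ^ 2 < s ^ 2 * t
  · -- Case A (`s² (−t) < δ²`): the rescaled point lies in the bounded region near the annulus
    have hwy' : ‖w (s ^ 2 * t) y‖ ≤ M' :=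
      (hM _ hcase hs2t y (hy ▸ hs1) (hy ▸ hs2.le)).trans (le_max_left _ _)
    have h1 : ‖w t x‖ ≤ l * M' / ‖x‖ := by
      rw [hwy]
      calc s * ‖w (s ^ 2 * t) y‖ ≤ s * M' := mul_le_mul_of_nonneg_left hwy' hs0.le
        _ ≤ l / ‖x‖ * M' := mul_le_mul_of_nonneg_right ((le_div_iff₀ hxpos).2 hs2.le) hM'0
        _ = l * M' / ‖x‖ := by rw [div_mul_eq_mul_div]
    have h3 : s * Real.sqrt (-t) < δ := by
      refine lt_of_pow_lt_pow_left₀ 2 hδ.le ?_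
      rw [hsq]
      linarith
    have h2 : Real.sqrt (-t) < δ * ‖x‖ := by
      calc Real.sqrt (-t) ≤ Real.sqrt (-t) * (s * ‖x‖) := le_mul_of_one_le_right hst.le hs1
        _ = s * Real.sqrt (-t) * ‖x‖ := by ring
        _ < δ * ‖x‖ := mul_lt_mul_of_pos_right h3 hxpos
    calc ‖w t x‖ ≤ l * M' / ‖x‖ := h1
      _ ≤ l * M' * (1 + δ) / (‖x‖ + Real.sqrt (-t)) :=
        div_le_mul_div_of_le (mul_nonneg hl0.le hM'0) hxpos hD (by linarith)
      _ ≤ max (C * (l / δ + 1)) (l * M' * (1 + δ)) / (‖x‖ + Real.sqrt (-t)) :=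
        div_le_div_of_nonneg_right (le_max_right _ _) hD.le
  · -- Case B (`δ² ≤ s² (−t)`): `δ ‖x‖ ≤ l √(−t)`, and the time rate suffices
    have h3 : δ ≤ s * Real.sqrt (-t) := by
      refine le_of_pow_le_pow_left₀ two_ne_zero (by positivity) ?_
      rw [hsq]
      linarith
    have h2 : δ * ‖x‖ ≤ l * Real.sqrt (-t) := by
      calc δ * ‖x‖ ≤ s * Real.sqrt (-t) * ‖x‖ := mul_le_mul_of_nonneg_right h3 (norm_nonneg _)
        _ = Real.sqrt (-t) * (s * ‖x‖) := by ring
        _ ≤ Real.sqrt (-t) * l := mul_le_mul_of_nonneg_left hs2.le hst.le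
        _ = l * Real.sqrt (-t) := mul_comm _ _
    have h5 : ‖x‖ ≤ l / δ * Real.sqrt (-t) := by
      rw [div_mul_eq_mul_div, le_div_iff₀ hδ, mul_comm]
      exact h2
    calc ‖w t x‖ ≤ C / Real.sqrt (-t) := hdec t ht x
      _ ≤ C * (l / δ + 1) / (‖x‖ + Real.sqrt (-t)) :=
        div_le_mul_div_of_le hC hst hD (by linarith)
      _ ≤ max (C * (l / δ + 1)) (l * M' * (1 + δ)) / (‖x‖ + Real.sqrt (-t)) :=
        div_le_div_of_nonneg_right (le_max_left _ _) hD.le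

end Summit.NavierStokesRegularity.NavierStokesRegularity.Theorems.SymmetryModuliCountForcedSymmetry

end
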